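import Literature.AnabelianGeometry.AbsoluteAnabelian.DiagramsOfCategories
import Mathlib.CategoryTheory.SingleObj
import Mathlib.Combinatorics.Quiver.SingleObj
import Mathlib.Algebra.Group.TypeTags.Basic
import Mathlib.Tactic.Ring
import HarnessLib

/-!
# [AbsTopIII] Def 3.5 (ii): compatibility of families of homotopies (FACT-LIST F-0095) —
# structural lemmas; universal closure REFUTED

S. Mochizuki, *Topics in absolute anabelian geometry III*, J. Math. Sci. Univ. Tokyo 22 (2015)
[MochizukiAbsTopIII2015], Definition 3.5 (ii) p. 75 (manuscript pages, lit key
`paper:url-5493eb38cbb7`): "if `{ℋ_ι}` is a collection of families of homotopies on `𝒟`, then we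
shall say that `{ℋ_ι}` is compatible if there exists a family of homotopies `ℋ` on `𝒟` such that
`E_{ℋ_ι} ⊆ E_ℋ` and `ζ^ι_ϖ = ζ_ϖ` for every `ι` and `ϖ ∈ E_{ℋ_ι}`".

PROOF-ONLY companion of `DiagramsOfCategories.lean` (abc-iut-L4-t2; no definition, no instance,
nothing restated), abc-iut cell seat abc-iut-f-095 (F fact-proving wave, tranche 95; FACT-LIST row
**F-0095** `DiagramOfCategories.HomotopyFamily.Compatible`, class `preparatory`, kernel_closedness
`parametrised`, status `conditional` via `HomotopyFamily.compatible_restrictBoundary`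
(`DiagramLifts.lean`, the instance form at restrictions of ONE family)).

The row is a PREDICATE on a collection `H : ι → 𝒟.HomotopyFamily`.  Structural facts (what the
definition gives every consumer):

* `Compatible.η_eq` — compatible families AGREE on every common boundary pair (the only
  obstruction);
* `compatible_const`, `Compatible.precomp`, `compatible_of_isEmpty` — a constant collection, any
  sub-collection of a compatible collection, and the empty collection are compatible.

As for every schema row (FACT-LIST rule R5) the fully quantified closure
"`∀ 𝒟 ι (H : ι → 𝒟.HomotopyFamily), Compatible 𝒟 H`" is NOT a theorem:
`HomotopyFamily.not_forall_compatible` builds, on the one-vertex one-loop graph carrying the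
one-object category of the group `ℤ` and the identity functor, the families `ℋ_k` (`k ∈ ℤ`) with
boundary set ALL co-verticial pairs and homotopy `ζ^k_{([γ₁],[γ₂])}` = the central element
`k·(ℓ(γ₂) − ℓ(γ₁)) ∈ ℤ`; each is a family of homotopies, and `ℋ_0`, `ℋ_1` disagree on the pair
`(∅, [e])`, so `{ℋ_k}` is not compatible.  The row is admissible only in instance form (as every
consumer uses it: contact structures `Telecore.IsContactStructure`, [AbsTopIII] Cor. 3.6 (ii) etc.).
Pure category theory; nothing here bears on the disputed [IUTchIII] Cor. 3.12 or takes a side;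
refuted ≠ fact; typed ≠ proved elsewhere.
-/

namespace Literature.AnabelianGeometry.AbsoluteAnabelian

open _root_.CategoryTheory _root_.Quiver

universe v u w

namespace DiagramOfCategories

variable {V : Type w} [Quiver.{v} V] {D : DiagramOfCategories.{v, u, w} V}

/-! ### Structural lemmas -/

/-- **Compatible families agree on common boundary pairs**: if `{ℋ_ι}` is compatible then
`ζ^i_ϖ = ζ^j_ϖ` whenever `ϖ ∈ E_{ℋ_i} ∩ E_{ℋ_j}` (both equal `ζ_ϖ` of the common family).
[cite: MochizukiAbsTopIII2015, Definition 3.5 (ii) p.75] -/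
theorem HomotopyFamily.Compatible.η_eq {ι : Type*} {H : ι → D.HomotopyFamily}
    (hH : HomotopyFamily.Compatible D H) {i j : ι} {a b : V} {p q : Path a b} (hi : (H i).E p q)
    (hj : (H j).E p q) : (H i).η hi = (H j).η hj := by
  obtain ⟨K, hK⟩ := hH
  obtain ⟨hsubi, hηi⟩ := hK i
  obtain ⟨hsubj, hηj⟩ := hK j
  rw [hηi hi, hηj hj]

/-- A constant collection `{ℋ}` is compatible (witnessed by `ℋ` itself).
[cite: MochizukiAbsTopIII2015, Definition 3.5 (ii) p.75] -/
theorem HomotopyFamily.compatible_const {ι : Type*} (K : D.HomotopyFamily) :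
    HomotopyFamily.Compatible D (fun _ : ι => K) :=
  ⟨K, fun _ => ⟨fun _ _ _ _ h => h, fun _ _ _ _ _ => rfl⟩⟩

/-- Any re-indexed sub-collection of a compatible collection is compatible (same witness).
[cite: MochizukiAbsTopIII2015, Definition 3.5 (ii) p.75] -/
theorem HomotopyFamily.Compatible.precomp {ι κ : Type*} {H : ι → D.HomotopyFamily}
    (hH : HomotopyFamily.Compatible D H) (f : κ → ι) : HomotopyFamily.Compatible D (H ∘ f) := by
  obtain ⟨K, hK⟩ := hH
  exact ⟨K, fun k => hK (f k)⟩

/-- The empty collection is compatible (witnessed by the family with empty boundary set, which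
every diagram carries). [cite: MochizukiAbsTopIII2015, Definition 3.5 (ii) p.75] -/
theorem HomotopyFamily.compatible_of_isEmpty {ι : Type*} [IsEmpty ι] (H : ι → D.HomotopyFamily) :
    HomotopyFamily.Compatible D H :=
  ⟨{ E := fun _ _ _ _ => False
     isSaturated :=
       { refl_left := fun _ _ _ _ h => h.elim
         refl_right := fun _ _ _ _ h => h.elim
         trans := fun _ _ _ _ _ h _ => h.elim
         precomp := fun _ _ _ _ _ h _ => h.elim
         postcomp := fun _ _ _ _ _ h _ => h.elim }
     η := fun _ _ _ _ h => h.elim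
     η_refl := fun _ _ _ h => h.elim
     η_trans := fun _ _ _ _ _ h _ => h.elim
     η_whisker := fun _ _ _ _ _ _ h _ _ => h.elim }, fun i => isEmptyElim i⟩

/-! ### F-0095: the universal closure of `Compatible` is false -/

/-- **F-0095, universal closure REFUTED.**  On the one-vertex graph with one loop `e` let `𝒟` carry
the one-object category of the (commutative) group `ℤ` and `𝒟_e = id`.  For `k ∈ ℤ` the family
`ℋ_k` — boundary set all co-verticial pairs, `ζ^k_{([γ₁],[γ₂])}` the natural transformation with
the single central component `k·(ℓ(γ₂) − ℓ(γ₁))` — is a family of homotopies (identities on the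
diagonal, composites add, whiskering by path functors = identity functors changes nothing), and
`ζ^0_{(∅,[e])} = 0 ≠ 1 = ζ^1_{(∅,[e])}`; so `{ℋ_k}_{k ∈ ℤ}` is NOT compatible and
"`∀ 𝒟 ι H, Compatible 𝒟 H`" is not a theorem. [cite: MochizukiAbsTopIII2015, Definition 3.5 (ii) p.75] -/
theorem HomotopyFamily.not_forall_compatible :
    ¬ ∀ (W : Type) [Quiver.{0} W] (𝒟 : DiagramOfCategories.{0, 0, 0} W) (ι : Type)
        (H : ι → 𝒟.HomotopyFamily),
        Literature.AnabelianGeometry.AbsoluteAnabelian.DiagramOfCategories.HomotopyFamily.Compatible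
          𝒟 H := by
  intro h
  -- the toy diagram: one vertex, one loop, the one-object category of `ℤ`, identity functor
  let C : Type := CategoryTheory.SingleObj (Multiplicative ℤ)
  let 𝒟 : DiagramOfCategories.{0, 0, 0} (Quiver.SingleObj PUnit.{1}) :=
    { obj := fun _ => C, map := fun _ => 𝟭 C }
  -- every path functor is the identity functor (all `𝒟_e` are)
  have hF : ∀ {a b : Quiver.SingleObj PUnit.{1}} (p : Path a b), 𝒟.pathFunctor p = 𝟭 C := by
    intro a b p
    induction p with
    | nil => exact 𝒟.pathFunctor_nil _
    | cons p e ih =>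
      rw [pathFunctor_cons, ih]
      exact Functor.comp_id (𝟭 C)
  -- bookkeeping in the one-object category: composition is multiplication, identities and
  -- `eqToHom`s are the unit, and path functors act trivially on morphisms
  have hcomp : ∀ {a : Quiver.SingleObj PUnit.{1}} {A B B' : 𝒟.obj a} (f : A ⟶ B) (g : B ⟶ B'),
      f ≫ g = @HMul.hMul (Multiplicative ℤ) (Multiplicative ℤ) (Multiplicative ℤ) instHMul g f :=
    fun f g => rfl
  have hid : ∀ {a : Quiver.SingleObj PUnit.{1}} (A : 𝒟.obj a), 𝟙 A = (1 : Multiplicative ℤ) :=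
    fun A => rfl
  have heq1 : ∀ {a : Quiver.SingleObj PUnit.{1}} {A B : 𝒟.obj a} (e : A = B),
      eqToHom e = (1 : Multiplicative ℤ) := by
    intro a A B e
    cases e
    rfl
  have hmap : ∀ {a b : Quiver.SingleObj PUnit.{1}} (p : Path a b) {X Y : 𝒟.obj a} (f : X ⟶ Y),
      (𝒟.pathFunctor p).map f = f := by
    intro a b p X Y f
    rw [Functor.congr_hom (hF p) f, heq1, heq1, Functor.id_map, hcomp, hcomp, mul_one, one_mul]
  -- the homotopies `ζ^k_{([γ₁],[γ₂])}`: the central element `k·(ℓ(γ₂) − ℓ(γ₁))`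
  let θ : ∀ (k : ℤ) {a b : Quiver.SingleObj PUnit.{1}} (p q : Path a b),
      (𝒟.pathFunctor p ⟶ 𝒟.pathFunctor q) := fun k a b p q =>
    { app := fun X => Multiplicative.ofAdd (k * ((q.length : ℤ) - p.length))
      naturality := fun X Y f => by
        rw [hmap p f, hmap q f, hcomp, hcomp]
        exact @mul_comm (Multiplicative ℤ) _ _ _ }
  have θ_app : ∀ (k : ℤ) {a b : Quiver.SingleObj PUnit.{1}} (p q : Path a b) (X : 𝒟.obj a),
      (θ k p q).app X = Multiplicative.ofAdd (k * ((q.length : ℤ) - p.length)) :=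
    fun _ _ _ _ _ _ => rfl
  -- the families `ℋ_k`, boundary set = all co-verticial pairs
  let fam : ℤ → 𝒟.HomotopyFamily := fun k =>
    { E := covert
      isSaturated := isSymmSaturated_covert.toIsSaturated
      η := fun _ _ p q _ => θ k p q
      η_refl := fun _ _ p _ => by
        ext X
        rw [θ_app, NatTrans.id_app, hid, sub_self, mul_zero, ofAdd_zero]
      η_trans := fun _ _ p q r _ _ => by
        ext X
        rw [NatTrans.comp_app, θ_app, θ_app, θ_app, hcomp, ← ofAdd_add]
        congr 1
        ring
      η_whisker := fun _ _ _ _ p q _ r₁ r₂ => by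
        ext X
        rw [θ_app, NatTrans.comp_app, NatTrans.comp_app, eqToHom_app, eqToHom_app, heq1, heq1,
          Functor.whiskerLeft_app, Functor.whiskerRight_app, hmap, θ_app, hcomp, hcomp, mul_one,
          one_mul, Path.length_comp, Path.length_comp, Path.length_comp, Path.length_comp]
        congr 1
        push_cast
        ring }
  obtain ⟨K, hK⟩ := h (Quiver.SingleObj PUnit.{1}) 𝒟 ℤ fam
  obtain ⟨hsub₀, hη₀⟩ := hK 0
  obtain ⟨hsub₁, hη₁⟩ := hK 1
  -- the pair `(∅, [e])` at the vertex, on which `ℋ_0` and `ℋ_1` disagree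
  let e : (Quiver.SingleObj.star PUnit.{1}) ⟶ (Quiver.SingleObj.star PUnit.{1}) :=
    Quiver.SingleObj.toHom PUnit.unit
  have h₀ : (fam 0).E Path.nil (Path.nil.cons e) := trivial
  have h₁ : (fam 1).E Path.nil (Path.nil.cons e) := trivial
  have hagree : (fam 0).η h₀ = (fam 1).η h₁ := by rw [hη₀ h₀, hη₁ h₁]
  have key : (θ 0 Path.nil (Path.nil.cons e)).app (Quiver.SingleObj.star (Multiplicative ℤ)) =
      (θ 1 Path.nil (Path.nil.cons e)).app (Quiver.SingleObj.star (Multiplicative ℤ)) :=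
    congrArg (fun t : 𝒟.pathFunctor Path.nil ⟶ 𝒟.pathFunctor (Path.nil.cons e) =>
      t.app (Quiver.SingleObj.star (Multiplicative ℤ))) hagree
  rw [θ_app, θ_app, Path.length_cons, Path.length_nil] at key
  have key' := congrArg Multiplicative.toAdd key
  rw [toAdd_ofAdd, toAdd_ofAdd] at key'
  norm_num at key'

end DiagramOfCategories

end Literature.AnabelianGeometry.AbsoluteAnabelian
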